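import Literature.AlgebraicGeometry.Resolution.EtaleVanishingIdeal
import Literature.AlgebraicGeometry.Resolution.BlowupDisjointCentreWeights
import Literature.AlgebraicGeometry.Resolution.StrictNormalCrossingsHasSNC
import Literature.AlgebraicGeometry.Resolution.BlowupRelativeDimension
import Literature.AlgebraicGeometry.Resolution.SubschemeRegularStalks
import Literature.AlgebraicGeometry.Resolution.CoefficientIdealRestriction
import HarnessLib

/-!
# Crux `PatchingRelPerfect` (stmt-ResolutionOfSingularities-16161), chain W5.2 — T6-E1b residual `LegalScopedDivisorReduction₃`,
# PHASE 2 closer (2b), spec D4-inv: the loop invariant «trace inside a strict normal crossings divisor» survives a curve move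

[OURS · L1 W5.2 · res-L1-w52-lead-1 g5, hand #3b; spec `L/res-L1-w52-lead-1/PHASE2-STEPB-SPEC.md` §D4 refined, D4-inv]
Replaces the role of NO printed item; NOT a statement of the manuscript under review; fact-free.

The invariant of the curve-move loop (`DepthLegal.curve_loop`, oracle shape `CurveOracle`) is
`Inv := ∃ BX, IsStrictNormalCrossingsDivisor X BX ∧ Supp T ⊆ BX` on the active host `X = V(D)` (STEP A's export).  Under a curve
move the induced map of hosts `π_X : X′ → X` is an isomorphism and the traces satisfy `T𝒪_{X′} = P · T′` (`HostStateN.curve_move`);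
so `BX′ := π_X⁻¹ BX` is again a strict normal crossings divisor (`IsStrictNormalCrossingsDivisor.preimage_of_etale`) and
`Supp T′ ⊆ Supp (P · T′) = π_X⁻¹ Supp T ⊆ BX′`.

D4-stalk / D4-reg (common lemmas of the oracle): for a closed subscheme `ι : X = V(D) ↪ E` and points `ζ ⤳ x` of `X`, the stalk of the
ideal of the closed curve `cl{ι ζ} ⊂ E` at `ι x` is the preimage of the stalk of the ideal of `cl{ζ} ⊂ X` at `x`
(`stalkIdeal_vanishingIdeal_closure_map`, from `comap_stalkMap_primeOfSpecializes`); hence `𝒪_{E,ιx}/𝓘_E(cl ιζ) ≅ 𝒪_{X,x}/𝓘_X(cl ζ)` and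
the reduced curve `cl{ι ζ}` is a regular subscheme of `E` as soon as `cl{ζ}` is a regular subscheme of `X`
(`isRegular_subscheme_vanishingIdeal_closure_map`).

AI-written; AI review is weaker than expert review.

## References
* A. J. de Jong, Publ. Math. IHÉS 83 (1996), 2.4. [DeJong1996]
* The Stacks Project, Tag 01J7. [StacksProject]
-/

-- `Summit.<Summit>.<Sub>.Theorems` with `Sub = Summit` (single-conjunct summit, D-0017)
set_option linter.dupNamespace false

noncomputable section

open CategoryTheory CategoryTheory.Limits AlgebraicGeometry TopologicalSpace
open Literature.AlgebraicGeometry.Resolution Scheme.IdealSheafData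

namespace Summit.ResolutionOfSingularities.ResolutionOfSingularities.Theorems

universe u

namespace DepthLegal

/-- [OURS · L1 W5.2] **D4-inv**: the invariant «the trace lies in a strict normal crossings divisor» passes along an isomorphism of
hosts `π_X` with `T𝒪 = P · T′`. [cite: DeJong1996, 2.4] -/
theorem snc_inv_step {X X' : Scheme.{u}} [IsLocallyNoetherian X] (πX : X' ⟶ X) [IsIso πX]
    {T : X.IdealSheafData} {P T' : X'.IdealSheafData} (hfac : T.comap πX = P * T')
    (h : ∃ BX : Set X, IsStrictNormalCrossingsDivisor X BX ∧ (T.support : Set X) ⊆ BX) :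
    ∃ BX' : Set X', IsStrictNormalCrossingsDivisor X' BX' ∧ (T'.support : Set X') ⊆ BX' := by
  obtain ⟨BX, hBX, hT⟩ := h
  refine ⟨πX ⁻¹' BX, hBX.preimage_of_etale πX, fun x' hx' => ?_⟩
  have hle : P * T' ≤ T' := Scheme.IdealSheafData.le_def.mpr fun U => by
    rw [Scheme.IdealSheafData.ideal_mul, Pi.mul_apply]; exact Ideal.mul_le_left
  have h1 : x' ∈ (P * T').support := support_antitone hle hx'
  rw [← hfac] at h1
  exact hT ((mem_support_comap_iff πX T x').mp h1)

/-- [OURS · L1 W5.2] **D4-stalk**: for `ι : V(D) ↪ E` and `ζ ⤳ x` in `V(D)`, `𝓘_E(cl{ι ζ})_{ι x} = (ι^♯_x)⁻¹ 𝓘_{V(D)}(cl{ζ})_x`.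
[cite: StacksProject, Tag 01J7] -/
theorem stalkIdeal_vanishingIdeal_closure_map {E : Scheme.{u}} (D : E.IdealSheafData) {ζ x : D.subscheme} (h : ζ ⤳ x) :
    stalkIdeal (vanishingIdeal ⟨closure {D.subschemeι ζ}, isClosed_closure⟩ : E.IdealSheafData) (D.subschemeι x) =
      (stalkIdeal (vanishingIdeal ⟨closure {ζ}, isClosed_closure⟩ : D.subscheme.IdealSheafData) x).comap
        (D.subschemeι.stalkMap x).hom := by
  rw [stalkIdeal_vanishingIdeal_closure_singleton h, stalkIdeal_vanishingIdeal_closure_singleton (h.map D.subschemeι.continuous),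
    comap_stalkMap_primeOfSpecializes]

/-- [OURS · L1 W5.2] **D4-reg**: if the reduced closure `cl{ζ}` of a point of the closed subscheme `V(D)` is a regular subscheme of
`V(D)`, then the reduced closure `cl{ι ζ}` is a regular subscheme of `E` (the local rings of the two reduced structures agree,
`𝒪_{E,ιx}/𝓘_E(cl ιζ) ≅ 𝒪_{V(D),x}/𝓘_{V(D)}(cl ζ)`, by D4-stalk and the surjectivity of `ι^♯`). [cite: StacksProject, Tag 01J7] -/
theorem isRegular_subscheme_vanishingIdeal_closure_map {E : Scheme.{u}} [IsLocallyNoetherian E] (D : E.IdealSheafData)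
    (ζ : D.subscheme)
    (h : Scheme.IsRegular (vanishingIdeal ⟨closure {ζ}, isClosed_closure⟩ : D.subscheme.IdealSheafData).subscheme) :
    Scheme.IsRegular (vanishingIdeal ⟨closure {D.subschemeι ζ}, isClosed_closure⟩ : E.IdealSheafData).subscheme := by
  haveI : IsLocallyNoetherian D.subscheme := LocallyOfFiniteType.isLocallyNoetherian D.subschemeι
  rw [Scheme.isRegular_subscheme_iff] at h ⊢
  intro y hy
  -- `y = ι x` with `ζ ⤳ x`
  have hy' : D.subschemeι ζ ⤳ y := mem_support_vanishingIdeal_closure_singleton_iff.mp hy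
  have hycl : y ∈ D.subschemeι '' closure {ζ} := by
    rw [← D.subschemeι.isClosedEmbedding.closure_image_eq, Set.image_singleton]
    exact specializes_iff_mem_closure.mp hy'
  obtain ⟨x, hx, rfl⟩ := hycl
  have hζx : ζ ⤳ x := specializes_iff_mem_closure.mpr hx
  have hX := h x (mem_support_vanishingIdeal_closure_singleton_iff.mpr hζx)
  -- the quotients agree
  have hsurj : Function.Surjective (D.subschemeι.stalkMap x).hom := D.subschemeι.stalkMap_surjective x
  have hψ : Function.Surjective ((Ideal.Quotient.mk (stalkIdeal (vanishingIdeal ⟨closure {ζ}, isClosed_closure⟩ :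
      D.subscheme.IdealSheafData) x)).comp (D.subschemeι.stalkMap x).hom) :=
    Ideal.Quotient.mk_surjective.comp hsurj
  have hker : RingHom.ker ((Ideal.Quotient.mk (stalkIdeal (vanishingIdeal ⟨closure {ζ}, isClosed_closure⟩ :
      D.subscheme.IdealSheafData) x)).comp (D.subschemeι.stalkMap x).hom) =
      stalkIdeal (vanishingIdeal ⟨closure {D.subschemeι ζ}, isClosed_closure⟩ : E.IdealSheafData) (D.subschemeι x) := by
    rw [← RingHom.comap_ker, Ideal.mk_ker, stalkIdeal_vanishingIdeal_closure_map D hζx]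
  haveI := hX
  exact IsRegularLocalRing.of_ringEquiv
    ((RingHom.quotientKerEquivOfSurjective hψ).symm.trans (Ideal.quotEquivOfEq hker))

end DepthLegal

end Summit.ResolutionOfSingularities.ResolutionOfSingularities.Theorems
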